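import Mathlib.LinearAlgebra.BilinearMap
import Mathlib.Algebra.Homology.HomologicalComplex
import Mathlib.Algebra.Category.ModuleCat.Basic
import HarnessLib

/-!
# The complex `Hom_R(K•, M)` of a cochain complex of modules into a module

Layer `Literature/Algebra/Homology`, namespace `Literature.Algebra.Homology`.  DEFINITIONS + `rfl`-lemmas only (plumbing for the dual
`K^∨ = Hom_R(K•, R)` of a Grothendieck complex, [MumfordAV1970] §13, [EGAIII2] (7.7.6): the module `Q` representing `T ↦ H⁰(X_T, F_T)` is
`H⁰` of the dual of the Grothendieck complex).

For a commutative ring `R`, a cochain complex `K•` of `R`-modules (`CochainComplex (ModuleCat R) ℤ`) and an `R`-module `M`: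
* `homComplex K M` — the COCHAIN complex with `(Hom(K•, M))ⁱ := Hom_R(K^{-i}, M)` and differential `φ ↦ φ ∘ d_K` (precomposition,
  no signs: `d : Hom(K^{-i}, M) → Hom(K^{-j}, M)` is `∘ d_K^{-j → -i}` for `i + 1 = j`).  With this indexing a complex `K•` in degrees
  `[0, g]` has `Hom(K•, M)` in degrees `[-g, 0]`, and `H⁰(Hom(K•, R)) = coker(Hom(K¹,R) → Hom(K⁰,R))`.
* `rfl`-lemmas `homComplex_X`, `homComplex_d_apply` (`d φ = φ ∘ₗ d_K`), `homComplex_d_apply_apply`.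
* `homComplexMap K f : homComplex K M ⟶ homComplex K N` for `f : M →ₗ[R] N` (postcomposition) and its `rfl`-lemma.

## References
* [EGAIII2] A. Grothendieck, *EGA III₂* (1963), (7.7.6) (the module `Q` with `H⁰(X_T, F ⊗ 𝒪_T) = Hom(Q, 𝒪_T)`).
* [MumfordAV1970] D. Mumford, *Abelian Varieties* (1970), §13 (pp. 125–130) (the dual `Hom(K•, 𝒪)` of the Grothendieck complex of the
  Poincaré bundle).
* [BrunsHerzog1998] W. Bruns, J. Herzog, *Cohen–Macaulay rings*, rev. ed. (1998), §1.1 (p. 4) and §1.3 (dual complexes `F•^*`).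
-/

universe v u

open CategoryTheory

namespace Literature.Algebra.Homology

variable {R : Type u} [CommRing R]

section Def

variable (K : CochainComplex (ModuleCat.{v} R) ℤ) (M : Type v) [AddCommGroup M] [Module R M]

/-- **The complex `Hom_R(K•, M)`**: `(Hom(K•, M))ⁱ = Hom_R(K^{-i}, M)`, `d φ = φ ∘ d_K`. [cite: EGAIII2, (7.7.6)]
[cite: MumfordAV1970, §13 (pp. 125–130)] [cite: BrunsHerzog1998, §1.1 (p. 4)] -/
noncomputable def homComplex : CochainComplex (ModuleCat.{v} R) ℤ where
  X i := ModuleCat.of R (K.X (-i) →ₗ[R] M)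
  d i j := ModuleCat.ofHom (LinearMap.lcomp R M (K.d (-j) (-i)).hom)
  shape i j hij := by
    have h : ¬ (ComplexShape.up ℤ).Rel (-j) (-i) := fun h => hij (by simp only [ComplexShape.up_Rel] at h ⊢; omega)
    rw [K.shape _ _ h]
    ext φ x
    simp only [ModuleCat.hom_ofHom, LinearMap.lcomp_apply, ModuleCat.hom_zero, LinearMap.zero_apply, map_zero]
  d_comp_d' i j l _ _ := by
    ext φ x
    simp only [ModuleCat.hom_comp, ModuleCat.hom_ofHom, LinearMap.comp_apply, LinearMap.lcomp_apply]
    change φ ((K.d (-j) (-i)).hom ((K.d (-l) (-j)).hom x)) = 0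
    rw [← ModuleCat.comp_apply, K.d_comp_d]
    simp

/-- The terms of `Hom(K•, M)`. [cite: EGAIII2, (7.7.6)] [cite: BrunsHerzog1998, §1.1 (p. 4)] -/
theorem homComplex_X (i : ℤ) : (homComplex K M).X i = ModuleCat.of R (K.X (-i) →ₗ[R] M) := rfl

/-- The differential of `Hom(K•, M)`: `d φ = φ ∘ₗ d_K`. [cite: EGAIII2, (7.7.6)] [cite: BrunsHerzog1998, §1.1 (p. 4)] -/
theorem homComplex_d_apply (i j : ℤ) (φ : K.X (-i) →ₗ[R] M) :
    ((homComplex K M).d i j).hom φ = φ ∘ₗ (K.d (-j) (-i)).hom := rfl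

/-- The differential of `Hom(K•, M)` on elements: `(d φ) x = φ (d_K x)`. [cite: EGAIII2, (7.7.6)] [cite: BrunsHerzog1998, §1.1 (p. 4)] -/
theorem homComplex_d_apply_apply (i j : ℤ) (φ : K.X (-i) →ₗ[R] M) (x : K.X (-j)) :
    (show K.X (-j) →ₗ[R] M from ((homComplex K M).d i j).hom φ) x = φ ((K.d (-j) (-i)).hom x) := rfl

end Def

section Map

variable (K : CochainComplex (ModuleCat.{v} R) ℤ) {M N : Type v} [AddCommGroup M] [Module R M] [AddCommGroup N] [Module R N]

/-- **Functoriality of `Hom(K•, −)`**: postcomposition with `f : M → N`. [cite: EGAIII2, (7.7.6)] [cite: BrunsHerzog1998, §1.1 (p. 4)] -/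
noncomputable def homComplexMap (f : M →ₗ[R] N) : homComplex K M ⟶ homComplex K N where
  f i := ModuleCat.ofHom (LinearMap.compRight R f (M := K.X (-i)))
  comm' i j _ := by
    ext φ
    rfl

/-- `homComplexMap` on elements: `φ ↦ f ∘ₗ φ`. [cite: EGAIII2, (7.7.6)] [cite: BrunsHerzog1998, §1.1 (p. 4)] -/
theorem homComplexMap_f_apply (f : M →ₗ[R] N) (i : ℤ) (φ : K.X (-i) →ₗ[R] M) :
    (((homComplexMap K f).f i).hom φ : K.X (-i) →ₗ[R] N) = f ∘ₗ φ := rfl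

end Map

end Literature.Algebra.Homology
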